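import Mathlib
import Summits.Ventures.PercRepro2.CoinChainReduction

/-!
# The head hypotheses of the chain theorems for the pure-chain data
(blind cell PercRepro2, night-2 g19; proofs/NIGHT2-DARC.md §59.8)

`chainPhi` is monotone, commutes with unions and is sub-multiplicative on intersections
(`chainPhi_mono/union/inter`); with the head function `A` nonnegative, antitone and
log-supermodular (`OrTailU.head_props`) the data `A ∘ chainPhi`, `A (chainPhi · ∪ {a})`,
`A (chainPhi · ∪ {a, w})` satisfy every standard head hypothesis of the chain theorems —
`d ≤ c`, `d' ≤ d`, the six log-supermodularity conditions and the three ratio conditions —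
for ALL pairs of clusters (the meets that pick up `a` or `w` are handled by antitonicity):
`chainPhi_head_hyps`.
-/

namespace Summit.Ventures.PercRepro2.Coin

section ChainHeadHyps

variable {V : Type*} {E : Type*} [Fintype V] [DecidableEq V] [Fintype E] [DecidableEq E]
  {R : Type*} [Field R] [LinearOrder R] [IsStrictOrderedRing R]

omit [Fintype V] [Fintype E] [DecidableEq E] in
/-- `chainPhi` is monotone. -/
lemma chainPhi_mono (ent' : Finset V) (a' : V) {s t : Finset V} (hst : s ⊆ t) :
    chainPhi ent' a' s ⊆ chainPhi ent' a' t := by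
  unfold chainPhi
  by_cases hs : ∃ r ∈ ent', r ∈ s
  · have ht : ∃ r ∈ ent', r ∈ t := by obtain ⟨r, hr, hrs⟩ := hs; exact ⟨r, hr, hst hrs⟩
    rw [if_pos hs, if_pos ht]; exact Finset.union_subset_union hst (Finset.Subset.refl _)
  · rw [if_neg hs]
    split_ifs
    · exact hst.trans Finset.subset_union_left
    · exact hst

omit [Fintype V] [Fintype E] [DecidableEq E] in
/-- `chainPhi` commutes with unions. -/
lemma chainPhi_union (ent' : Finset V) (a' : V) (s t : Finset V) :
    chainPhi ent' a' (s ∪ t) = chainPhi ent' a' s ∪ chainPhi ent' a' t := by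
  unfold chainPhi
  have hu : (∃ r ∈ ent', r ∈ s ∪ t) ↔ (∃ r ∈ ent', r ∈ s) ∨ (∃ r ∈ ent', r ∈ t) :=
    meets_union_iff
  by_cases hs : ∃ r ∈ ent', r ∈ s <;> by_cases ht : ∃ r ∈ ent', r ∈ t
  all_goals simp only [hu, hs, ht, or_self, or_true, or_false, if_true, if_false]
  · ext v; simp only [Finset.mem_union, Finset.mem_singleton]; tauto
  · ext v; simp only [Finset.mem_union, Finset.mem_singleton]; tauto
  · ext v; simp only [Finset.mem_union, Finset.mem_singleton]; tauto

omit [Fintype V] [Fintype E] [DecidableEq E] in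
/-- `chainPhi (s ∩ t) ⊆ chainPhi s ∩ chainPhi t`. -/
lemma chainPhi_inter (ent' : Finset V) (a' : V) (s t : Finset V) :
    chainPhi ent' a' (s ∩ t) ⊆ chainPhi ent' a' s ∩ chainPhi ent' a' t :=
  Finset.subset_inter (chainPhi_mono ent' a' Finset.inter_subset_left)
    (chainPhi_mono ent' a' Finset.inter_subset_right)

omit [Fintype V] [Fintype E] [DecidableEq E] in
/-- The standard head hypotheses of the chain theorems for the data `A ∘ chainPhi` etc.,
from the head properties (`A ≥ 0`, antitone, log-supermodular). -/
lemma chainPhi_head_hyps (A : Finset V → R) (ent' : Finset V) (a' a w : V)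
    (hA0 : ∀ X, 0 ≤ A X) (hAmono : ∀ X Y, X ⊆ Y → A Y ≤ A X)
    (hAlsm : ∀ X Y, A X * A Y ≤ A (X ∩ Y) * A (X ∪ Y)) :
    (∀ W, A (chainPhi ent' a' W ∪ {a}) ≤ A (chainPhi ent' a' W)) ∧
    (∀ W, A (chainPhi ent' a' W ∪ {a, w}) ≤ A (chainPhi ent' a' W ∪ {a})) ∧
    (∀ s t, A (chainPhi ent' a' s) * A (chainPhi ent' a' t) ≤
      A (chainPhi ent' a' (s ∩ t)) * A (chainPhi ent' a' (s ∪ t))) ∧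
    (∀ s t, A (chainPhi ent' a' s ∪ {a}) * A (chainPhi ent' a' t ∪ {a}) ≤
      A (chainPhi ent' a' (s ∩ t) ∪ {a}) * A (chainPhi ent' a' (s ∪ t) ∪ {a})) ∧
    (∀ s t, A (chainPhi ent' a' s ∪ {a, w}) * A (chainPhi ent' a' t ∪ {a, w}) ≤
      A (chainPhi ent' a' (s ∩ t) ∪ {a, w}) * A (chainPhi ent' a' (s ∪ t) ∪ {a, w})) ∧
    (∀ s t, A (chainPhi ent' a' s ∪ {a}) * A (chainPhi ent' a' t ∪ {a, w}) ≤
      A (chainPhi ent' a' (s ∩ t) ∪ {a}) * A (chainPhi ent' a' (s ∪ t) ∪ {a, w})) ∧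
    (∀ s t, s ⊆ t → A (chainPhi ent' a' s ∪ {a}) * A (chainPhi ent' a' t) ≤
      A (chainPhi ent' a' s) * A (chainPhi ent' a' t ∪ {a})) ∧
    (∀ s t, s ⊆ t → A (chainPhi ent' a' s ∪ {a, w}) * A (chainPhi ent' a' t) ≤
      A (chainPhi ent' a' s) * A (chainPhi ent' a' t ∪ {a, w})) ∧
    (∀ s t, s ⊆ t → A (chainPhi ent' a' s ∪ {a, w}) * A (chainPhi ent' a' t ∪ {a}) ≤
      A (chainPhi ent' a' s ∪ {a}) * A (chainPhi ent' a' t ∪ {a, w})) ∧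
    (∀ s t, A (chainPhi ent' a' s) * A (chainPhi ent' a' t ∪ {a}) ≤
      A (chainPhi ent' a' (s ∩ t)) * A (chainPhi ent' a' (s ∪ t) ∪ {a})) ∧
    (∀ s t, A (chainPhi ent' a' s) * A (chainPhi ent' a' t ∪ {a, w}) ≤
      A (chainPhi ent' a' (s ∩ t)) * A (chainPhi ent' a' (s ∪ t) ∪ {a, w})) := by
  have hφm : ∀ {s t : Finset V}, s ⊆ t → chainPhi ent' a' s ⊆ chainPhi ent' a' t :=
    fun hst => chainPhi_mono ent' a' hst
  have hφu := chainPhi_union ent' a'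
  have hφi := chainPhi_inter ent' a'
  refine ⟨fun W => hAmono _ _ Finset.subset_union_left,
    fun W => hAmono _ _ (Finset.union_subset_union_right
      (Finset.singleton_subset_iff.2 (Finset.mem_insert_self a {w}))), ?_, ?_, ?_, ?_, ?_, ?_, ?_,
    ?_, ?_⟩
  · -- hcc
    intro s' t'
    calc A (chainPhi ent' a' s') * A (chainPhi ent' a' t')
        ≤ A (chainPhi ent' a' s' ∩ chainPhi ent' a' t') *
            A (chainPhi ent' a' s' ∪ chainPhi ent' a' t') := hAlsm _ _
      _ ≤ A (chainPhi ent' a' (s' ∩ t')) * A (chainPhi ent' a' (s' ∪ t')) := by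
          rw [← hφu]
          exact mul_le_mul_of_nonneg_right (hAmono _ _ (hφi s' t')) (hA0 _)
  · -- hdd
    intro s' t'
    calc A (chainPhi ent' a' s' ∪ {a}) * A (chainPhi ent' a' t' ∪ {a})
        ≤ A ((chainPhi ent' a' s' ∪ {a}) ∩ (chainPhi ent' a' t' ∪ {a})) *
            A ((chainPhi ent' a' s' ∪ {a}) ∪ (chainPhi ent' a' t' ∪ {a})) := hAlsm _ _
      _ ≤ A (chainPhi ent' a' (s' ∩ t') ∪ {a}) * A (chainPhi ent' a' (s' ∪ t') ∪ {a}) := by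
          rw [union_union_same, ← hφu]
          refine mul_le_mul_of_nonneg_right (hAmono _ _ ?_) (hA0 _)
          exact Finset.subset_inter
            (Finset.union_subset_union (Finset.Subset.trans (hφi s' t') Finset.inter_subset_left)
              (Finset.Subset.refl _))
            (Finset.union_subset_union (Finset.Subset.trans (hφi s' t') Finset.inter_subset_right)
              (Finset.Subset.refl _))
  · -- hd'd'
    intro s' t'
    calc A (chainPhi ent' a' s' ∪ {a, w}) * A (chainPhi ent' a' t' ∪ {a, w})
        ≤ A ((chainPhi ent' a' s' ∪ {a, w}) ∩ (chainPhi ent' a' t' ∪ {a, w})) *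
            A ((chainPhi ent' a' s' ∪ {a, w}) ∪ (chainPhi ent' a' t' ∪ {a, w})) := hAlsm _ _
      _ ≤ A (chainPhi ent' a' (s' ∩ t') ∪ {a, w}) * A (chainPhi ent' a' (s' ∪ t') ∪ {a, w}) := by
          rw [union_union_same, ← hφu]
          refine mul_le_mul_of_nonneg_right (hAmono _ _ ?_) (hA0 _)
          exact Finset.subset_inter
            (Finset.union_subset_union (Finset.Subset.trans (hφi s' t') Finset.inter_subset_left)
              (Finset.Subset.refl _))
            (Finset.union_subset_union (Finset.Subset.trans (hφi s' t') Finset.inter_subset_right)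
              (Finset.Subset.refl _))
  · -- hdd'
    intro s' t'
    calc A (chainPhi ent' a' s' ∪ {a}) * A (chainPhi ent' a' t' ∪ {a, w})
        ≤ A ((chainPhi ent' a' s' ∪ {a}) ∩ (chainPhi ent' a' t' ∪ {a, w})) *
            A ((chainPhi ent' a' s' ∪ {a}) ∪ (chainPhi ent' a' t' ∪ {a, w})) := hAlsm _ _
      _ ≤ A (chainPhi ent' a' (s' ∩ t') ∪ {a}) * A (chainPhi ent' a' (s' ∪ t') ∪ {a, w}) := by
          rw [union_a_union_aw, ← hφu]
          refine mul_le_mul_of_nonneg_right (hAmono _ _ ?_) (hA0 _)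
          refine Finset.subset_inter
            (Finset.union_subset_union (Finset.Subset.trans (hφi s' t') Finset.inter_subset_left)
              (Finset.Subset.refl _))
            (Finset.union_subset_union (Finset.Subset.trans (hφi s' t') Finset.inter_subset_right)
              (Finset.singleton_subset_iff.2 (Finset.mem_insert_self a {w})))
  · -- hratio : d s · c t ≤ c s · d t for s ⊆ t
    intro s' t' hst
    have h1 := hAlsm (chainPhi ent' a' s' ∪ {a}) (chainPhi ent' a' t')
    have hsub : chainPhi ent' a' s' ⊆ (chainPhi ent' a' s' ∪ {a}) ∩ chainPhi ent' a' t' :=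
      Finset.subset_inter Finset.subset_union_left (hφm hst)
    have hjoin : (chainPhi ent' a' s' ∪ {a}) ∪ chainPhi ent' a' t' = chainPhi ent' a' t' ∪ {a} := by
      rw [Finset.union_right_comm, Finset.union_eq_right.2 (hφm hst)]
    rw [hjoin] at h1
    calc A (chainPhi ent' a' s' ∪ {a}) * A (chainPhi ent' a' t')
        ≤ A ((chainPhi ent' a' s' ∪ {a}) ∩ chainPhi ent' a' t') * A (chainPhi ent' a' t' ∪ {a}) := h1
      _ ≤ A (chainPhi ent' a' s') * A (chainPhi ent' a' t' ∪ {a}) :=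
          mul_le_mul_of_nonneg_right (hAmono _ _ hsub) (hA0 _)
  · -- hratio' : d' s · c t ≤ c s · d' t
    intro s' t' hst
    have h1 := hAlsm (chainPhi ent' a' s' ∪ {a, w}) (chainPhi ent' a' t')
    have hsub : chainPhi ent' a' s' ⊆ (chainPhi ent' a' s' ∪ {a, w}) ∩ chainPhi ent' a' t' :=
      Finset.subset_inter Finset.subset_union_left (hφm hst)
    have hjoin : (chainPhi ent' a' s' ∪ {a, w}) ∪ chainPhi ent' a' t' =
        chainPhi ent' a' t' ∪ {a, w} := by
      rw [Finset.union_right_comm, Finset.union_eq_right.2 (hφm hst)]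
    rw [hjoin] at h1
    calc A (chainPhi ent' a' s' ∪ {a, w}) * A (chainPhi ent' a' t')
        ≤ A ((chainPhi ent' a' s' ∪ {a, w}) ∩ chainPhi ent' a' t') *
            A (chainPhi ent' a' t' ∪ {a, w}) := h1
      _ ≤ A (chainPhi ent' a' s') * A (chainPhi ent' a' t' ∪ {a, w}) :=
          mul_le_mul_of_nonneg_right (hAmono _ _ hsub) (hA0 _)
  · -- hratio'' : d' s · d t ≤ d s · d' t
    intro s' t' hst
    have h1 := hAlsm (chainPhi ent' a' s' ∪ {a, w}) (chainPhi ent' a' t' ∪ {a})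
    have hsub : chainPhi ent' a' s' ∪ {a} ⊆
        (chainPhi ent' a' s' ∪ {a, w}) ∩ (chainPhi ent' a' t' ∪ {a}) :=
      Finset.subset_inter
        (Finset.union_subset_union (Finset.Subset.refl _)
          (Finset.singleton_subset_iff.2 (Finset.mem_insert_self a {w})))
        (Finset.union_subset_union (hφm hst) (Finset.Subset.refl _))
    have hjoin : (chainPhi ent' a' s' ∪ {a, w}) ∪ (chainPhi ent' a' t' ∪ {a}) =
        chainPhi ent' a' t' ∪ {a, w} := by
      rw [union_aw_union_a]
      congr 1
      exact Finset.union_eq_right.2 (hφm hst)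
    rw [hjoin] at h1
    calc A (chainPhi ent' a' s' ∪ {a, w}) * A (chainPhi ent' a' t' ∪ {a})
        ≤ A ((chainPhi ent' a' s' ∪ {a, w}) ∩ (chainPhi ent' a' t' ∪ {a})) *
            A (chainPhi ent' a' t' ∪ {a, w}) := h1
      _ ≤ A (chainPhi ent' a' s' ∪ {a}) * A (chainPhi ent' a' t' ∪ {a, w}) :=
          mul_le_mul_of_nonneg_right (hAmono _ _ hsub) (hA0 _)
  · -- hcd : c s · d t ≤ c (s ∩ t) · d (s ∪ t)
    intro s' t'
    have h1 := hAlsm (chainPhi ent' a' s') (chainPhi ent' a' t' ∪ {a})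
    have hjoin : chainPhi ent' a' s' ∪ (chainPhi ent' a' t' ∪ {a}) =
        chainPhi ent' a' (s' ∪ t') ∪ {a} := by rw [hφu, Finset.union_assoc]
    rw [hjoin] at h1
    refine le_trans h1 (mul_le_mul_of_nonneg_right (hAmono _ _ ?_) (hA0 _))
    exact Finset.Subset.trans (hφi s' t')
      (Finset.inter_subset_inter (Finset.Subset.refl _) Finset.subset_union_left)
  · -- hcd' : c s · d' t ≤ c (s ∩ t) · d' (s ∪ t)
    intro s' t'
    have h1 := hAlsm (chainPhi ent' a' s') (chainPhi ent' a' t' ∪ {a, w})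
    have hjoin : chainPhi ent' a' s' ∪ (chainPhi ent' a' t' ∪ {a, w}) =
        chainPhi ent' a' (s' ∪ t') ∪ {a, w} := by rw [hφu, Finset.union_assoc]
    rw [hjoin] at h1
    refine le_trans h1 (mul_le_mul_of_nonneg_right (hAmono _ _ ?_) (hA0 _))
    exact Finset.Subset.trans (hφi s' t')
      (Finset.inter_subset_inter (Finset.Subset.refl _) Finset.subset_union_left)

omit [Fintype V] [Fintype E] [DecidableEq E] [LinearOrder R] [IsStrictOrderedRing R] in
/-- The avoidance event of `X ∪ {a}` is the avoidance event of `X` intersected with «`a` does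
not reach `t`». -/
lemma coreAvoidEvent_union_singleton (arcs : E → Finset (V × V)) (s t : V) (C X : Finset V)
    (a : V) :
    coreAvoidEvent arcs s t C (X ∪ {a}) =
      coreAvoidEvent arcs s t C X ∩ {ω | ¬ Reach (coreOff arcs C) ω a t} := by
  ext ω
  simp only [coreAvoidEvent, Set.mem_inter_iff, Set.mem_setOf_eq, Finset.mem_insert,
    Finset.mem_union, Finset.mem_singleton]
  constructor
  · intro h
    exact ⟨fun v hv => h v (by tauto), h a (by tauto)⟩
  · rintro ⟨h1, h2⟩ v hv
    rcases hv with rfl | hv | rfl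
    · exact h1 _ (Or.inl rfl)
    · exact h1 v (Or.inr hv)
    · exact h2

omit [Fintype V] [LinearOrder R] [IsStrictOrderedRing R] in
/-- The `a`-difference of the head function is the probability of «`X` avoids `t` and `a`
reaches `t`». -/
lemma coreAvoid_diff_eq (pr : E → R) (arcs : E → Finset (V × V)) (s t : V) (C X : Finset V)
    (a : V) :
    prob pr (coreAvoidEvent arcs s t C X) - prob pr (coreAvoidEvent arcs s t C (X ∪ {a})) =
      prob pr (coreAvoidEvent arcs s t C X ∩ {ω | ¬ Reach (coreOff arcs C) ω a t}ᶜ) := by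
  rw [coreAvoidEvent_union_singleton]
  have := prob_inter_add_prob_inter_compl pr (coreAvoidEvent arcs s t C X)
    {ω | ¬ Reach (coreOff arcs C) ω a t}
  linear_combination -this

omit [Fintype V] [Fintype E] [DecidableEq E] [LinearOrder R] [IsStrictOrderedRing R] in
/-- The avoidance event is antitone in the avoided set. -/
lemma coreAvoidEvent_anti (arcs : E → Finset (V × V)) (s t : V) (C : Finset V) {X Y : Finset V}
    (hXY : X ⊆ Y) : coreAvoidEvent arcs s t C Y ⊆ coreAvoidEvent arcs s t C X := by
  intro ω hω v hv
  exact hω v (Finset.insert_subset_insert s hXY hv)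

omit [Fintype V] in
/-- **The `a`-difference of the head function is antitone** (`hDanti` of the corollaries holds
for every head). -/
lemma coreAvoid_diff_anti (pr : E → R) (hp : IsProbVec pr) (arcs : E → Finset (V × V)) (s t : V)
    (C : Finset V) (a : V) {X Y : Finset V} (hXY : X ⊆ Y) :
    prob pr (coreAvoidEvent arcs s t C Y) - prob pr (coreAvoidEvent arcs s t C (Y ∪ {a})) ≤
      prob pr (coreAvoidEvent arcs s t C X) - prob pr (coreAvoidEvent arcs s t C (X ∪ {a})) := by
  rw [coreAvoid_diff_eq, coreAvoid_diff_eq]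
  exact prob_mono_of_subset pr hp
    (Set.inter_subset_inter_left _ (coreAvoidEvent_anti arcs s t C hXY))

end ChainHeadHyps

end Summit.Ventures.PercRepro2.Coin
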